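import Literature.MathematicalPhysics.QuantumFieldTheory.Balaban1983to89.B6RandomWalkL2
import Literature.MathematicalPhysics.QuantumFieldTheory.Balaban1983to89.B6Prop26ReachTransplant

/-!
# `Balaban1983to89.B6RandomWalkL2Transplant` — T. Bałaban, *Propagators and renormalization transformations for lattice gauge theories. II*,
# Commun. Math. Phys. **96** (1984) 223–250 [Balaban1984PropagatorsII], (2.133) p. 247 with p. 238 (`T_□ = □̃³`) IN THE `L²` NORMS OF (2.140): a
# block-`ℓ²` majorant of a member operator on its own lattice `T_□` TRANSPORTS through the window chart to the global lattice (the `ℓ²` twin of r03's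
# `B6InMajorantTransplant.inMajorant_transplant`; file 5 of the block-`ℓ²` bricks of `…B6RandomWalkL2`)

statement-level skeleton of published theorems with citation tags; proofs where landed; nothing here is a claim about the Yang–Mills mass gap

WHAT IS PRINTED (p. 247 [PDF 25], render `inprint/lit-balaban-p05/renders/cmp96/p25.png`): *"At first we will formulate the relevant inequalities for G_□
rescaled back to η-scale. We have |(G_□J)(x)|, |(∇G_□J)(x)| ≤ O(1)[(Lʲη)², Lʲη]e^{−δ₂(Lʲη)⁻¹dist(Δ,Δ′)}|J|, (2.133) for x ∈ Δ(y), supp J ⊂ Δ(y′), y, y′ ∈ 𝔅 ∩ T_□"*;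
p. 246 [PDF 24] Prop. 2.5: *"The operator G_□ … satisfies all the inequalities (1.110)–(1.114) of the Proposition 1.2"* ((1.114) = the `L²` members); p. 238
[PDF 16]: the member lives on the torus `T_□ = □̃³` identified with a window of `T_η`.

CITATION HEADER (lean-in-tree rule) — WHAT IS REPRODUCED.  Phase-2 file of the `lit-balaban` typed skeleton (HOME `run/shared/lean/pub/lit-balaban/`), seat
**p22 gen 29** (free-target protocol G.5-34(d), TAKING HOME/STATUS 2026-08-24T13:26Z, cc r03); SKELETON row **B6.Prop2.6** × B6.Eq2.133 × B6.Txt@238 (cells only;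
decls of record untouched).  The cell reads the member `G_□` of a cube on its own finite lattice `X′` (the window chart `e : X → X′` injective on the window
`W`, r03's `B6Prop26ReachTransplant.transplant W e T′ = extend ∘ T′ ∘ restrict`), and r03's `B6InMajorantTransplant.inMajorant_transplant` moves a SUP majorant
of `T′` to the transplanted operator.  THIS FILE is the same transport for the block-`ℓ²` majorants of `…B6RandomWalkL2` — the device by which the `L²`
members (1.114) of Prop. 2.5 for `G_□` will feed the `L²` walk (2.141) of `…B6RandomWalkL2Chain/…Gluing`:
* §1 `l2n_restrictOp_le` (`‖ρf‖ ≤ ‖f‖` for a chart injective on the window), `l2n_blockPiece_extendOp_sq_le` / `l2n_blockPiece_extendOp_le` (the block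
  sums of `extend` through the fibres of the chart);
* §2 **`InL2Majorant blk T S K`** (def with body: the block-`ℓ²` majorant required for INPUT blocks `y′ ∈ S` only — the `ℓ²` twin of r03's `InMajorant`),
  `inL2Majorant_of_hasL2Majorant`, `inL2Majorant_mono`;
* §3 **`inL2Majorant_transplant`** — if `T′` has the block-`ℓ²` majorant `K′` on the local lattice, `e` is injective on `W`, the kernels compare
  (`K′(y′(ex), y′(ex₁)) ≤ K(y(x), y(x₁))` for window bonds with `y(x₁) ∈ S`) and every global block is charted into at most `n` local blocks, then
  `transplant W e T′` has the input-localised block-`ℓ²` majorant `n²·K` on `S` (the sup twin has `n·K`; the extra `n` is the price of the crude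
  `‖Δ′(b)ν‖ ≤ ‖ν‖` per local block — a fixed geometric number downstream).
Def with body: `InL2Majorant` (§2).  No `def … : Prop` fact, no new hypothesis beyond r03's transplant hypotheses; IMPORTS BY NAME; standard axioms.

HONEST SCOPE / DIVERGENCES.  (1) Finite-dimensional bookkeeping; which member operators and charts satisfy the hypotheses (the V1 window charts of
`B6CubeWindowV1`, the fibre counts `hfib_sites`) is r03's sup-side data, reusable verbatim — not re-derived here.  (2) Unweighted `ℓ²` sums on both lattices.
(3) Toward the unowned census slots (2.140)₄₋₆; NOT those slots.  NOT summit progress.  Unit `lit-balaban-p22` (gen 29), 2026-08-24.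
-/

noncomputable section

open scoped BigOperators
open Finset

namespace Literature.MathematicalPhysics.QuantumFieldTheory.Balaban1983to89.B6RandomWalkL2Transplant

open B6RandomWalk (blockPiece sum_blockPiece)
open B6RandomWalkL2 (l2n l2n_nonneg l2n_sq l2n_zero l2n_sum_le l2n_mono l2n_blockPiece_le blockPiece_sum blockPiece_off HasL2Majorant hasL2Majorant_mono)
open B6Prop26ReachTransplant (transplant restrictOp extendOp transplant_apply restrictOp_apply restrictOp_apply_of_injOn restrictOp_apply_of_not_mem
  extendOp_apply)

/-! ## §1  `ℓ²` sizes through the chart: restriction and extension -/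

section Chart

variable {X X' : Type} [Fintype X] [Fintype X'] [DecidableEq X'] [DecidableEq X] {W : Finset X} {e : X → X'}

omit [DecidableEq X] in
/-- `‖ρf‖ ≤ ‖f‖`: the restriction to the window followed by the injective chart does not increase the `ℓ²` size.
[cite: Balaban1984PropagatorsII, p.238 (T_□ = □̃³), dictionary (charts); bookkeeping ours] -/
theorem l2n_restrictOp_le (hinj : Set.InjOn e ↑W) (f : X → ℝ) : l2n (restrictOp W e f) ≤ l2n f := by
  -- pointwise: `(ρf)(x′)² = Σ_{x ∈ W, e x = x′} f(x)²` (the fibre has at most one point)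
  have hfib : ∀ x', restrictOp W e f x' ^ 2 ≤ ∑ x ∈ W.filter (fun x => e x = x'), f x ^ 2 := by
    intro x'
    by_cases hex : ∃ x ∈ W, e x = x'
    · obtain ⟨x, hx, rfl⟩ := hex
      have hfilter : W.filter (fun x₁ => e x₁ = e x) = {x} := by
        ext x₁
        simp only [Finset.mem_filter, Finset.mem_singleton]
        exact ⟨fun h => hinj h.1 hx h.2, fun h => by subst h; exact ⟨hx, rfl⟩⟩
      rw [restrictOp_apply_of_injOn hinj f hx, hfilter, Finset.sum_singleton]
    · push Not at hex
      rw [restrictOp_apply_of_not_mem f hex]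
      simpa using Finset.sum_nonneg fun x _ => sq_nonneg (f x)
  have h2 : l2n (restrictOp W e f) ^ 2 ≤ l2n f ^ 2 := by
    rw [l2n_sq, l2n_sq]
    calc ∑ x', restrictOp W e f x' ^ 2 ≤ ∑ x', ∑ x ∈ W.filter (fun x => e x = x'), f x ^ 2 := Finset.sum_le_sum fun x' _ => hfib x'
      _ = ∑ x ∈ W, f x ^ 2 := by rw [Finset.sum_fiberwise W e fun x => f x ^ 2]
      _ ≤ ∑ x, f x ^ 2 := Finset.sum_le_sum_of_subset_of_nonneg (Finset.subset_univ W) fun x _ _ => sq_nonneg (f x)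
  have := Real.sqrt_le_sqrt h2
  rwa [Real.sqrt_sq (l2n_nonneg _), Real.sqrt_sq (l2n_nonneg _)] at this

/-- the block sums of an extension: for a global block `y`, if the window bonds of `Δ(y)` are charted into the local blocks of `F`, then
`‖Δ(y)·extend g‖² ≤ Σ_{x′ : y′(x′) ∈ F} g(x′)²` (injectivity of the chart on the window). [cite: Balaban1984PropagatorsII, p.238 (T_□ = □̃³), dictionary (charts); bookkeeping ours] -/
theorem l2n_blockPiece_extendOp_sq_le {g : B6.Geometry} {g' : B6.Geometry} (blk : X → g.Site) (blk' : X' → g'.Site) (hinj : Set.InjOn e ↑W)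
    (y : g.Site) (F : Finset g'.Site) (hF : ∀ x ∈ W, blk x = y → blk' (e x) ∈ F) (gv : X' → ℝ) :
    l2n (blockPiece blk y (extendOp W e gv)) ^ 2 ≤ ∑ b ∈ F, l2n (blockPiece blk' b gv) ^ 2 := by
  classical
  set A : Finset X := W.filter (fun x => blk x = y) with hA
  have hAinj : Set.InjOn e ↑A := fun x hx x₁ hx₁ h =>
    hinj (Finset.mem_filter.mp (Finset.mem_coe.mp hx)).1 (Finset.mem_filter.mp (Finset.mem_coe.mp hx₁)).1 h
  -- left side as a sum over A
  have hL : l2n (blockPiece blk y (extendOp W e gv)) ^ 2 = ∑ x ∈ A, gv (e x) ^ 2 := by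
    rw [l2n_sq, hA, Finset.sum_filter]
    have h1 : ∑ x, blockPiece blk y (extendOp W e gv) x ^ 2 = ∑ x ∈ W, blockPiece blk y (extendOp W e gv) x ^ 2 :=
      (Finset.sum_subset (Finset.subset_univ W) (fun x _ hxW => by
        by_cases hx : blk x = y <;> simp [blockPiece, hx, extendOp_apply, hxW])).symm
    rw [h1]
    refine Finset.sum_congr rfl fun x hxW => ?_
    by_cases hx : blk x = y <;> simp [blockPiece, hx, extendOp_apply, hxW]
  -- right side as a sum over the local bonds of the blocks of F
  have hR : ∑ b ∈ F, l2n (blockPiece blk' b gv) ^ 2 = ∑ x', (if blk' x' ∈ F then gv x' ^ 2 else 0) := by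
    simp_rw [l2n_sq]
    rw [Finset.sum_comm]
    refine Finset.sum_congr rfl fun x' _ => ?_
    have : ∀ b ∈ F, blockPiece blk' b gv x' ^ 2 = if blk' x' = b then gv x' ^ 2 else 0 := fun b _ => by
      by_cases hb : blk' x' = b <;> simp [blockPiece, hb]
    rw [Finset.sum_congr rfl this, Finset.sum_ite_eq]
  rw [hL, hR]
  -- reindex the left sum through the injective chart
  calc ∑ x ∈ A, gv (e x) ^ 2 = ∑ x' ∈ A.image e, gv x' ^ 2 := by rw [Finset.sum_image hAinj]
    _ = ∑ x' ∈ A.image e, (if blk' x' ∈ F then gv x' ^ 2 else 0) := by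
        refine Finset.sum_congr rfl fun x' hx' => ?_
        obtain ⟨x, hx, rfl⟩ := Finset.mem_image.mp hx'
        obtain ⟨hxW, hxy⟩ := Finset.mem_filter.mp hx
        rw [if_pos (hF x hxW hxy)]
    _ ≤ ∑ x', (if blk' x' ∈ F then gv x' ^ 2 else 0) :=
        Finset.sum_le_sum_of_subset_of_nonneg (Finset.subset_univ _) fun x' _ _ => by
          split_ifs
          · exact sq_nonneg _
          · exact le_rfl

/-- `(Σ_{b∈F} a_b²)^{1/2} ≤ Σ_{b∈F} a_b` for `a_b ≥ 0`, in the form used below: `‖Δ(y)·extend g‖ ≤ Σ_{b∈F} ‖Δ′(b)g‖`.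
[cite: Balaban1984PropagatorsII, p.238 (T_□), dictionary (charts); bookkeeping ours] -/
theorem l2n_blockPiece_extendOp_le {g : B6.Geometry} {g' : B6.Geometry} (blk : X → g.Site) (blk' : X' → g'.Site) (hinj : Set.InjOn e ↑W)
    (y : g.Site) (F : Finset g'.Site) (hF : ∀ x ∈ W, blk x = y → blk' (e x) ∈ F) (gv : X' → ℝ) :
    l2n (blockPiece blk y (extendOp W e gv)) ≤ ∑ b ∈ F, l2n (blockPiece blk' b gv) := by
  have h2 := l2n_blockPiece_extendOp_sq_le blk blk' hinj y F hF gv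
  have hsq : ∑ b ∈ F, l2n (blockPiece blk' b gv) ^ 2 ≤ (∑ b ∈ F, l2n (blockPiece blk' b gv)) ^ 2 :=
    Finset.sum_sq_le_sq_sum_of_nonneg fun b _ => l2n_nonneg _
  have := Real.sqrt_le_sqrt (h2.trans hsq)
  rwa [Real.sqrt_sq (l2n_nonneg _), Real.sqrt_sq (Finset.sum_nonneg fun b _ => l2n_nonneg _)] at this

end Chart

/-! ## §2  Input-localised block-`ℓ²` majorants -/

section InL2

variable {g : B6.Geometry} {X : Type} [Fintype X]

/-- THE BLOCK-`ℓ²` SHAPE OF (2.140) REQUIRED FOR INPUT BLOCKS `y′ ∈ S` ONLY (print's *"y, y′ ∈ 𝔅 ∩ T_□"* of (2.133) on the input side): `‖Δ(y)Tu‖ ≤ K(y,y′)‖u‖`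
for `supp u ⊂ Δ(y′)`, `y′ ∈ S`, all `y` — the `ℓ²` twin of `B6InMajorantTransplant.InMajorant`. [cite: Balaban1984PropagatorsII, (2.133) p.247 with (2.140) p.247] -/
def InL2Majorant (blk : X → g.Site) (T : Module.End ℝ (X → ℝ)) (S : Set g.Site) (K : g.Site → g.Site → ℝ) : Prop :=
  ∀ (y y' : g.Site), y' ∈ S → ∀ (u : X → ℝ), (∀ x, blk x ≠ y' → u x = 0) → l2n (blockPiece blk y (T u)) ≤ K y y' * l2n u

/-- a global block-`ℓ²` majorant is an input-localised one on every `S`. [cite: Balaban1984PropagatorsII, (2.133) p.247 (bookkeeping, ours)] -/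
theorem inL2Majorant_of_hasL2Majorant (blk : X → g.Site) {T : Module.End ℝ (X → ℝ)} {K : g.Site → g.Site → ℝ} (h : HasL2Majorant blk T K)
    (S : Set g.Site) : InL2Majorant blk T S K :=
  fun y y' _ u hu => h y y' u hu

/-- monotonicity. [cite: Balaban1984PropagatorsII, (2.133) p.247 (bookkeeping, ours)] -/
theorem inL2Majorant_mono (blk : X → g.Site) {T : Module.End ℝ (X → ℝ)} {S : Set g.Site} {K K' : g.Site → g.Site → ℝ}
    (h : InL2Majorant blk T S K) (hle : ∀ a b, K a b ≤ K' a b) : InL2Majorant blk T S K' :=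
  fun y y' hy' u hu => (h y y' hy' u hu).trans (mul_le_mul_of_nonneg_right (hle _ _) (l2n_nonneg u))

/-- on the whole of `𝔅` the two notions agree. [cite: Balaban1984PropagatorsII, (2.133) p.247 (bookkeeping, ours)] -/
theorem hasL2Majorant_of_inL2Majorant_univ (blk : X → g.Site) {T : Module.End ℝ (X → ℝ)} {K : g.Site → g.Site → ℝ}
    (h : InL2Majorant blk T Set.univ K) : HasL2Majorant blk T K :=
  fun y y' u hu => h y y' (Set.mem_univ _) u hu

end InL2

/-! ## §3  Transport of a block-`ℓ²` majorant through the window chart -/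

section Transplant

variable {X X' : Type} [Fintype X] [Fintype X'] [DecidableEq X'] [DecidableEq X] {W : Finset X} {e : X → X'}

/-- **TRANSPORT OF A BLOCK-`ℓ²` MAJORANT THROUGH THE CHART, INPUTS OVER `S`**: if `T′` has the block-`ℓ²` majorant `K′` on the local lattice, the chart
is injective on the window `W`, the kernels compare for window bonds `x` (outputs) and `x₁` (inputs, `y(x₁) ∈ S`), and every global block is charted into at
most `n` local blocks, then `‖Δ(y)(transplant T′)u‖ ≤ n²·K(y,y′)·‖u‖` for `supp u ⊂ Δ(y′)`, `y′ ∈ S` — the `ℓ²` twin of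
`B6InMajorantTransplant.inMajorant_transplant` (there `n·K`). [cite: Balaban1984PropagatorsII, (2.133) p.247 with p.238 (T_□ = □̃³), (2.140)–(2.141) p.247; derivation ours] -/
theorem inL2Majorant_transplant {g g' : B6.Geometry} (blk : X → g.Site) (blk' : X' → g'.Site) (S : Set g.Site)
    (hinj : Set.InjOn e ↑W) {T' : Module.End ℝ (X' → ℝ)} {K' : g'.Site → g'.Site → ℝ} (hT' : HasL2Majorant blk' T' K')
    (K : g.Site → g.Site → ℝ) (hK : ∀ a b, 0 ≤ K a b)
    (hcomp : ∀ x ∈ W, ∀ x₁ ∈ W, blk x₁ ∈ S → K' (blk' (e x)) (blk' (e x₁)) ≤ K (blk x) (blk x₁))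
    (n : ℕ) (hfib : ∀ y : g.Site, ∃ T : Finset g'.Site, T.card ≤ n ∧ ∀ x ∈ W, blk x = y → blk' (e x) ∈ T) :
    InL2Majorant blk (transplant W e T') S (fun a b => (n : ℝ) ^ 2 * K a b) := by
  classical
  intro y y' hy' u hu
  beta_reduce
  -- the charted input `ν = ρu`, its local blocks `F ⊆ T_{y′}`, and the local output blocks `Fy ⊆ T_y`
  set ν : X' → ℝ := restrictOp W e u with hν
  set F : Finset g'.Site := (W.filter (fun x => blk x = y')).image (fun x => blk' (e x)) with hF
  set Fy : Finset g'.Site := (W.filter (fun x => blk x = y)).image (fun x => blk' (e x)) with hFy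
  obtain ⟨Ty', hTy'n, hTy'⟩ := hfib y'
  obtain ⟨Ty, hTyn, hTy⟩ := hfib y
  have hFcard : F.card ≤ n := by
    refine (Finset.card_le_card fun b hb => ?_).trans hTy'n
    obtain ⟨x₁, hx₁, rfl⟩ := Finset.mem_image.mp hb
    obtain ⟨hx₁W, hbx₁⟩ := Finset.mem_filter.mp hx₁
    exact hTy' x₁ hx₁W hbx₁
  have hFycard : Fy.card ≤ n := by
    refine (Finset.card_le_card fun b hb => ?_).trans hTyn
    obtain ⟨x₁, hx₁, rfl⟩ := Finset.mem_image.mp hb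
    obtain ⟨hx₁W, hbx₁⟩ := Finset.mem_filter.mp hx₁
    exact hTy x₁ hx₁W hbx₁
  -- `ν` vanishes off the local blocks of `F`
  have hνoff : ∀ x', blk' x' ∉ F → ν x' = 0 := by
    intro x' hx'
    by_cases hex : ∃ x₁ ∈ W, e x₁ = x'
    · obtain ⟨x₁, hx₁, rfl⟩ := hex
      rw [hν, restrictOp_apply_of_injOn hinj u hx₁]
      by_cases hb : blk x₁ = y'
      · exact absurd (Finset.mem_image.mpr ⟨x₁, Finset.mem_filter.mpr ⟨hx₁, hb⟩, rfl⟩) hx'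
      · exact hu x₁ hb
    · push Not at hex
      rw [hν, restrictOp_apply_of_not_mem u hex]
  have hνsum : ν = ∑ b ∈ F, blockPiece blk' b ν := by
    have hsub : ∑ b ∈ F, blockPiece blk' b ν = ∑ b, blockPiece blk' b ν := by
      refine Finset.sum_subset (Finset.subset_univ F) fun b _ hbF => ?_
      funext x'
      by_cases hbx : blk' x' = b
      · simp [blockPiece, hbx, hνoff x' (hbx ▸ hbF)]
      · simp [blockPiece, hbx]
    rw [hsub, sum_blockPiece]
  -- each local output block `b ∈ Fy`: ‖Δ′(b) T′ν‖ ≤ Σ_{b₁ ∈ F} K′(b,b₁) ‖Δ′(b₁)ν‖ ≤ n · K(y,y′) · ‖u‖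
  have hνle : l2n ν ≤ l2n u := l2n_restrictOp_le hinj u
  have hblock : ∀ b ∈ Fy, l2n (blockPiece blk' b (T' ν)) ≤ n * K y y' * l2n u := by
    intro b hb
    obtain ⟨x, hx, rfl⟩ := Finset.mem_image.mp hb
    obtain ⟨hxW, hxy⟩ := Finset.mem_filter.mp hx
    have hdec : blockPiece blk' (blk' (e x)) (T' ν) = ∑ b₁ ∈ F, blockPiece blk' (blk' (e x)) (T' (blockPiece blk' b₁ ν)) := by
      conv_lhs => rw [hνsum, map_sum]
      rw [blockPiece_sum]
    have hterm : ∀ b₁ ∈ F, l2n (blockPiece blk' (blk' (e x)) (T' (blockPiece blk' b₁ ν))) ≤ K y y' * l2n u := by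
      intro b₁ hb₁
      obtain ⟨x₁, hx₁, rfl⟩ := Finset.mem_image.mp hb₁
      obtain ⟨hx₁W, hbx₁⟩ := Finset.mem_filter.mp hx₁
      have h1 := hT' (blk' (e x)) (blk' (e x₁)) (blockPiece blk' (blk' (e x₁)) ν) (blockPiece_off blk' _ ν)
      have hKK : K' (blk' (e x)) (blk' (e x₁)) ≤ K y y' := by
        have := hcomp x hxW x₁ hx₁W (hbx₁ ▸ hy')
        rwa [hxy, hbx₁] at this
      calc l2n (blockPiece blk' (blk' (e x)) (T' (blockPiece blk' (blk' (e x₁)) ν)))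
          ≤ K' (blk' (e x)) (blk' (e x₁)) * l2n (blockPiece blk' (blk' (e x₁)) ν) := h1
        _ ≤ K y y' * l2n u := mul_le_mul hKK ((l2n_blockPiece_le blk' _ ν).trans hνle) (l2n_nonneg _) (hK _ _)
    rw [hdec]
    calc l2n (∑ b₁ ∈ F, blockPiece blk' (blk' (e x)) (T' (blockPiece blk' b₁ ν)))
        ≤ ∑ b₁ ∈ F, l2n (blockPiece blk' (blk' (e x)) (T' (blockPiece blk' b₁ ν))) := l2n_sum_le _ _
      _ ≤ ∑ _b₁ ∈ F, K y y' * l2n u := Finset.sum_le_sum hterm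
      _ = F.card * (K y y' * l2n u) := by rw [Finset.sum_const, nsmul_eq_mul]
      _ ≤ n * (K y y' * l2n u) := mul_le_mul_of_nonneg_right (Nat.cast_le.mpr hFcard) (mul_nonneg (hK _ _) (l2n_nonneg u))
      _ = n * K y y' * l2n u := by ring
  -- assemble through the extension
  have hFy_mem : ∀ x ∈ W, blk x = y → blk' (e x) ∈ Fy := fun x hxW hxy =>
    Finset.mem_image.mpr ⟨x, Finset.mem_filter.mpr ⟨hxW, hxy⟩, rfl⟩
  have hTr : transplant W e T' u = extendOp W e (T' ν) := by
    funext x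
    rw [transplant_apply, extendOp_apply]
  rw [hTr]
  calc l2n (blockPiece blk y (extendOp W e (T' ν)))
      ≤ ∑ b ∈ Fy, l2n (blockPiece blk' b (T' ν)) := l2n_blockPiece_extendOp_le blk blk' hinj y Fy hFy_mem (T' ν)
    _ ≤ ∑ _b ∈ Fy, n * K y y' * l2n u := Finset.sum_le_sum hblock
    _ = Fy.card * (n * K y y' * l2n u) := by rw [Finset.sum_const, nsmul_eq_mul]
    _ ≤ n * (n * K y y' * l2n u) :=
        mul_le_mul_of_nonneg_right (Nat.cast_le.mpr hFycard) (mul_nonneg (mul_nonneg (Nat.cast_nonneg n) (hK _ _)) (l2n_nonneg u))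
    _ = (n : ℝ) ^ 2 * K y y' * l2n u := by ring

end Transplant

end Literature.MathematicalPhysics.QuantumFieldTheory.Balaban1983to89.B6RandomWalkL2Transplant
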